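import Summits.Ventures.HSemireg.WedgeHankelKernelColumnSpace
import Summits.Ventures.HSemireg.WedgeHankelOuterFamilyImageSum
import Summits.Ventures.HSemireg.WedgeHankelSecantKernel
import Literature.LinearAlgebra.IndependentSubspacesDimension

/-!
# Venture HSemireg — THE ADDITIVE RANK LAW: for a finite family of classes `w_N(q_c)` of one box and their SUM `w_N(Σ_c q_c)`, always `rank H_k(Σ_c q_c) ≤ rank [H_k(q_c)]_c ≤ Σ_c rank H_k(q_c)`,
# `Hom ⊓ ⋂_c Kr(w_N q_c, k) ⊆ Kr(w_N(Σ q_c), k)` and `V(w_N(Σ q_c), k′) ⊆ ⨆_c V(w_N q_c, k′)`; and **the kernel of the sum IS the joint kernel of the summands — equivalently the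
# image of the sum IS the sum of the images — IF AND ONLY IF `rank H_k(Σ_c q_c) = rank [H_k(q_c)]_c`**; in particular **ADDITIVE HANKEL RANK `rank H_k(Σ q_c) = Σ rank H_k(q_c)` ⇒
# `Kr(w_N(Σ q_c), k) = Hom ⊓ ⋂_c Kr(w_N q_c, k)`, `V(w_N(Σ q_c), k′) = ⨁_c V(w_N q_c, k′)` (a DIRECT sum)** — every field, every regime, no nodes, no weights

HONEST FRAMING. Part of the Lean index of the computation cell `pub-hsemireg` (seat p10 gen 25, Sunday typer «UNIFORM-IN-n»).
Finite-dimensional EXTERIOR ALGEBRA over a field + ranks / column spaces of Hankel matrices ONLY: no variety, no cohomology theory, no sheaf, no Ext group, no semiregularity map;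
nothing here says that HC / HC_CM / HC_AV holds; no Literature fact is declared or used.  Custodian versions as in `WedgeHankelSiegelIdeal` (1/3) and `WedgeKernelDuality` (E1); the
dictionary (`w_N(Σ q_c)` = the class of a sum, e.g. a divisor class as the sum of its node classes; `H_k` the catalecticant) is QUOTED, never asserted.

WHAT IS IN THE TREE.  J1 `finrank_iInf_Kr_w_top_add` (the joint kernel law `dim (Hom ⊓ ⋂_c Kr) + C(N,k)·rank [H_k(q_c)]_c = C(2N,k)`); M14 `rank_hank_eq_finrank_iSup_range` (block rank = `dim Σ_c col`),
`rank_hank_eq_rank_of_forall_range_le`; M11 `finrank_iSup_V_w` (the joint image law, `k + k′ = N`); `w_sum'` (`w` is additive in the coefficient sequence); the divisor laws F2a/F2b/F2d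
(`rank_hankel1_expMul_sum`, `Kr_w_expMul_sum`, `V_w_expMul_sum`, `iSupIndep_V_w_expMul`), E8–E10/F1/F3 (two nodes, `P¹` divisors), H6 — each proved by its own codimension count.
THIS FILE isolates the one mechanism behind them (namespace `Summit.Ventures.HSemireg.Wedge.HankelOuter` continued; imports M14, M11, D2 for `w_sum'`, th-7's `rank_hank_eq_zero_of_lt`, and
`Literature.LinearAlgebra.IndependentSubspacesDimension` for the dimension criterion of independence):
* §433 SUB-ADDITIVITY (every family): `hankel1_sum` (`H_k(Σ q_c) = Σ H_k(q_c)`), `range_hankel1_sum_le_iSup` (`col H_k(Σ q_c) ⊆ Σ_c col H_k(q_c)`), `rank_hankel1_sum_le_rank_hank`,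
  `rank_hank_le_sum_rank` (`Literature.LinearAlgebra.finrank_iSup_le_sum_finrank`), `rank_hankel1_sum_le_sum_rank`, **`Hom_iInf_Kr_w_le_Kr_w_sum`** (a form killing every summand kills
  the sum; any finite index type, cf. F2b's `Fin r` version), **`V_w_sum_le_iSup_V`** (with K36 `finrank_Kr_w_Dm_top` for the one-class kernel number).
* §434 **`Kr_w_sum_eq_Hom_iInf_Kr_iff_rank`: `Kr(w_N(Σ q_c), k) = Hom ⊓ ⋂_c Kr(w_N q_c, k) ↔ rank H_k(Σ q_c) = rank [H_k(q_c)]_c`**; `rank_hankel1_sum_eq_rank_hank_of_eq_sum`,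
  `rank_hank_eq_sum_rank_of_eq_sum` (additive rank squeezes the block rank), **`Kr_w_sum_eq_Hom_iInf_Kr_of_rank_eq_sum`** (THE ADDITIVE RANK LAW, kernel side),
  `range_hankel1_sum_eq_iSup_of_rank` (then `col H_k(Σ q_c) = Σ_c col H_k(q_c)`).
* §435 IMAGES (`k + k′ = N`): `finrank_V_w_mirror` (`dim V(univ, w_N q, k′) = C(N,k)·rank H_k(q)`), **`V_w_sum_eq_iSup_V_iff_rank`** (`V(w_N(Σ q_c), k′) = ⨆_c V(w_N q_c, k′) ↔` the same rank
  condition), `Kr_w_sum_eq_Hom_iInf_Kr_iff_V_w_sum_eq_iSup` (KERNELS INTERSECT ⇔ IMAGES ADD), and under ADDITIVE RANK `finrank_iSup_V_w_eq_sum_of_rank_eq_sum`,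
  **`iSupIndep_V_w_of_rank_eq_sum`** (the images are INDEPENDENT — `Literature.LinearAlgebra.iSupIndep_of_finrank_iSup_eq_sum`, Hoffman–Kunze §6.6), **`V_w_sum_eq_iSup_V_of_rank_eq_sum`**.
READING: one law for the whole atlas of «sums»: whenever the catalecticant rank of a sum of classes is the sum of the ranks (divisors of total order `D ≤ min(k+1, N+1−k)`, F2a; two nodes
incl. `∞`, E10; `P¹` divisors, F3a; any family in the uniform range, H6), the kernel of the sum is the intersection of the kernels and the images form a direct sum — and conversely the
kernel of a sum is the joint kernel EXACTLY when the rank of the sum reaches the block rank.  NOT typed here: which concrete families have additive rank beyond the atlas (fourth regime).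
Nothing Ext-side.  New names only.
-/

open Module

namespace Summit.Ventures.HSemireg.Wedge.HankelOuter

open Summit.Ventures.HSemireg.Wedge Summit.Ventures.HSemireg.Wedge.Kunneth Summit.Ventures.HSemireg.Wedge.Hankel
  Summit.Ventures.HSemireg.Wedge.BasisFree Summit.Ventures.HSemireg.Wedge.HankelSiegel Summit.Ventures.HSemireg.Wedge.HankelSiegelIdeal
  Summit.Ventures.HSemireg.Wedge.KunnethKernel Summit.Ventures.HSemireg.Wedge.HankelFrameChange Summit.Ventures.HSemireg.Wedge.KernelDuality
  Summit.Ventures.HSemireg.Wedge.HankelSecant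

variable (K : Type*) [Field K] {N : ℕ} {ι : Type} [Fintype ι] [DecidableEq ι]

/-! ## §433. Sums of classes: columns, ranks, kernels and images are sub-additive -/

omit [DecidableEq ι] in
/-- **`H_k(Σ_c q_c) = Σ_c H_k(q_c)`**: the catalecticant is linear in the coefficient sequence. -/
theorem hankel1_sum (k : ℕ) (q : ι → ℕ → K) : hankel1 K N k (∑ c, q c) = ∑ c, hankel1 K N k (q c) := by
  ext i s
  simp only [hankel1, Matrix.of_apply, Finset.sum_apply, Matrix.sum_apply]

omit [DecidableEq ι] in
/-- **`col H_k(Σ_c q_c) ⊆ Σ_c col H_k(q_c)`** (every column of the sum is the sum of the corresponding columns). -/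
theorem range_hankel1_sum_le_iSup (k : ℕ) (q : ι → ℕ → K) :
    LinearMap.range (hankel1 K N k (∑ c, q c)).mulVecLin ≤ ⨆ c, LinearMap.range (hankel1 K N k (q c)).mulVecLin := by
  rw [Matrix.range_mulVecLin, Submodule.span_le]
  rintro _ ⟨t, rfl⟩
  have hc : (hankel1 K N k (∑ c, q c)).col t = ∑ c, (hankel1 K N k (q c)).col t := by
    funext i
    simp only [hankel1_sum, Matrix.col_apply, Matrix.sum_apply, Finset.sum_apply]
  rw [SetLike.mem_coe, hc]
  exact Submodule.sum_mem _ fun c _ => Submodule.mem_iSup_of_mem c (by rw [Matrix.range_mulVecLin]; exact Submodule.subset_span ⟨t, rfl⟩)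

omit [DecidableEq ι] in
/-- **`rank H_k(Σ_c q_c) ≤ rank [H_k(q_c)]_c`** (the block rank is the dimension of the column sum, M14). -/
theorem rank_hankel1_sum_le_rank_hank (k : ℕ) (q : ι → ℕ → K) :
    (hankel1 K N k (∑ c, q c)).rank ≤ (hank K N k (fun (_ : Unit) (c : ι) => q c)).rank := by
  rw [rank_hank_eq_finrank_iSup_range, Matrix.rank]
  exact Submodule.finrank_mono (range_hankel1_sum_le_iSup K k q)

omit [DecidableEq ι] in
/-- **`rank [H_k(q_c)]_c ≤ Σ_c rank H_k(q_c)`.** -/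
theorem rank_hank_le_sum_rank (k : ℕ) (q : ι → ℕ → K) :
    (hank K N k (fun (_ : Unit) (c : ι) => q c)).rank ≤ ∑ c, (hankel1 K N k (q c)).rank := by
  rw [rank_hank_eq_finrank_iSup_range]
  exact Literature.LinearAlgebra.finrank_iSup_le_sum_finrank _

omit [DecidableEq ι] in
/-- **`rank H_k(Σ_c q_c) ≤ Σ_c rank H_k(q_c)`** (sub-additivity of the Hankel rank). -/
theorem rank_hankel1_sum_le_sum_rank (k : ℕ) (q : ι → ℕ → K) :
    (hankel1 K N k (∑ c, q c)).rank ≤ ∑ c, (hankel1 K N k (q c)).rank :=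
  (rank_hankel1_sum_le_rank_hank K k q).trans (rank_hank_le_sum_rank K k q)

omit [DecidableEq ι] in
/-- **a form killing every summand kills the sum: `Hom(univ,k) ⊓ ⋂_c Kr(univ, w_N q_c, k) ⊆ Kr(univ, w_N(Σ_c q_c), k)`** (`w_N` is additive). -/
theorem Hom_iInf_Kr_w_le_Kr_w_sum (k : ℕ) (q : ι → ℕ → K) :
    Hom K (In N) (Finset.univ : Finset (In N)) k ⊓ (⨅ c, Kr K (Finset.univ : Finset (In N)) (w K N N (q c)) k)
      ≤ Kr K (Finset.univ : Finset (In N)) (w K N N (∑ c, q c)) k := by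
  intro θ hθ
  rw [Submodule.mem_inf, Submodule.mem_iInf] at hθ
  refine mem_Kr.mpr ⟨hθ.1, ?_⟩
  rw [w_sum', Finset.mul_sum]
  exact Finset.sum_eq_zero fun c _ => (mem_Kr.mp (hθ.2 c)).2

omit [DecidableEq ι] in
/-- **the image of the sum lies in the sum of the images: `V(univ, w_N(Σ_c q_c), a) ⊆ ⨆_c V(univ, w_N q_c, a)`** (every degree `a`). -/
theorem V_w_sum_le_iSup_V (a : ℕ) (q : ι → ℕ → K) :
    V K (In N) Finset.univ (w K N N (∑ c, q c)) a ≤ ⨆ c, V K (In N) Finset.univ (w K N N (q c)) a := by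
  rw [V_eq_map, Submodule.map_le_iff_le_comap]
  intro θ hθ
  rw [Submodule.mem_comap, LinearMap.mulRight_apply, w_sum', Finset.mul_sum]
  exact Submodule.sum_mem _ fun c _ => Submodule.mem_iSup_of_mem c (by rw [V_eq_map]; exact Submodule.mem_map_of_mem hθ)

/-! ## §434. The additive rank law: kernels -/

/-- **THE KERNEL OF A SUM IS THE JOINT KERNEL OF THE SUMMANDS IFF THE HANKEL RANK OF THE SUM IS THE BLOCK HANKEL RANK OF THE FAMILY:
`Kr(univ, w_N(Σ_c q_c), k) = Hom(univ,k) ⊓ ⋂_c Kr(univ, w_N q_c, k) ↔ rank H_k(Σ_c q_c) = rank [H_k(q_c)]_c`** (every field, every `N`, `k`, every finite family). -/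
theorem Kr_w_sum_eq_Hom_iInf_Kr_iff_rank (k : ℕ) (q : ι → ℕ → K) :
    Kr K (Finset.univ : Finset (In N)) (w K N N (∑ c, q c)) k = Hom K (In N) (Finset.univ : Finset (In N)) k ⊓ ⨅ c, Kr K (Finset.univ : Finset (In N)) (w K N N (q c)) k
      ↔ (hankel1 K N k (∑ c, q c)).rank = (hank K N k (fun (_ : Unit) (c : ι) => q c)).rank := by
  have h1 := finrank_Kr_w_Dm_top K (N := N) k (∑ c, q c)
  have h2 := finrank_iInf_Kr_w_top_add K (N := N) k q
  constructor
  · intro h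
    rw [h] at h1
    rcases le_or_gt k N with hk | hk
    · exact Nat.eq_of_mul_eq_mul_left (Nat.choose_pos hk) (by omega)
    · have hw := Matrix.rank_le_width (hankel1 K N k (∑ c, q c))
      have h0 : N + 1 - k = 0 := by omega
      rw [rank_hank_eq_zero_of_lt K hk]
      omega
  · intro h
    rw [h] at h1
    exact (Submodule.eq_of_le_of_finrank_eq (Hom_iInf_Kr_w_le_Kr_w_sum K k q) (by omega)).symm

omit [DecidableEq ι] in
/-- additive rank squeezes the block rank from below: `rank H_k(Σ q_c) = Σ rank H_k(q_c) ⇒ rank H_k(Σ q_c) = rank [H_k(q_c)]_c` … -/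
theorem rank_hankel1_sum_eq_rank_hank_of_eq_sum (k : ℕ) (q : ι → ℕ → K) (h : (hankel1 K N k (∑ c, q c)).rank = ∑ c, (hankel1 K N k (q c)).rank) :
    (hankel1 K N k (∑ c, q c)).rank = (hank K N k (fun (_ : Unit) (c : ι) => q c)).rank :=
  le_antisymm (rank_hankel1_sum_le_rank_hank K k q) (by rw [h]; exact rank_hank_le_sum_rank K k q)

omit [DecidableEq ι] in
/-- … and from above: `rank [H_k(q_c)]_c = Σ_c rank H_k(q_c)`. -/
theorem rank_hank_eq_sum_rank_of_eq_sum (k : ℕ) (q : ι → ℕ → K) (h : (hankel1 K N k (∑ c, q c)).rank = ∑ c, (hankel1 K N k (q c)).rank) :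
    (hank K N k (fun (_ : Unit) (c : ι) => q c)).rank = ∑ c, (hankel1 K N k (q c)).rank := by
  rw [← rank_hankel1_sum_eq_rank_hank_of_eq_sum K k q h, h]

/-- **THE ADDITIVE RANK LAW: `rank H_k(Σ_c q_c) = Σ_c rank H_k(q_c) ⇒ Kr(univ, w_N(Σ_c q_c), k) = Hom(univ,k) ⊓ ⋂_c Kr(univ, w_N q_c, k)`** — the forms killing the sum are EXACTLY the
forms killing every summand (every field, every regime; F2b/E8/E9/F1/F3b/H6 are instances). -/
theorem Kr_w_sum_eq_Hom_iInf_Kr_of_rank_eq_sum (k : ℕ) (q : ι → ℕ → K) (h : (hankel1 K N k (∑ c, q c)).rank = ∑ c, (hankel1 K N k (q c)).rank) :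
    Kr K (Finset.univ : Finset (In N)) (w K N N (∑ c, q c)) k = Hom K (In N) (Finset.univ : Finset (In N)) k ⊓ ⨅ c, Kr K (Finset.univ : Finset (In N)) (w K N N (q c)) k :=
  (Kr_w_sum_eq_Hom_iInf_Kr_iff_rank K k q).mpr (rank_hankel1_sum_eq_rank_hank_of_eq_sum K k q h)

omit [DecidableEq ι] in
/-- column spaces: **`rank H_k(Σ q_c) = rank [H_k(q_c)]_c ⇒ col H_k(Σ_c q_c) = Σ_c col H_k(q_c)`.** -/
theorem range_hankel1_sum_eq_iSup_of_rank (k : ℕ) (q : ι → ℕ → K) (h : (hankel1 K N k (∑ c, q c)).rank = (hank K N k (fun (_ : Unit) (c : ι) => q c)).rank) :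
    LinearMap.range (hankel1 K N k (∑ c, q c)).mulVecLin = ⨆ c, LinearMap.range (hankel1 K N k (q c)).mulVecLin :=
  Submodule.eq_of_le_of_finrank_eq (range_hankel1_sum_le_iSup K k q) (by rw [← rank_hank_eq_finrank_iSup_range, ← h, Matrix.rank])

/-! ## §435. The additive rank law: images -/

/-- the image number of ONE class in the mirror degree: **`dim V(univ, w_N q, k′) = C(N,k) · rank H_k(q)`** for `k + k′ = N` (M11 for the one-member family). -/
theorem finrank_V_w_mirror {k k' : ℕ} (hkk' : k + k' = N) (q₀ : ℕ → K) :
    finrank K ↥(V K (In N) Finset.univ (w K N N q₀) k') = N.choose k * (hankel1 K N k q₀).rank := by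
  have h := finrank_iSup_V_w K hkk' (fun (_ : Unit) => q₀)
  rwa [iSup_const, rank_hank_eq_rank_of_forall_range_le K k (fun (_ : Unit) => q₀) () (fun _ => le_rfl)] at h

/-- **THE IMAGE OF A SUM IS THE SUM OF THE IMAGES IFF THE HANKEL RANK OF THE SUM IS THE BLOCK RANK: `V(univ, w_N(Σ q_c), k′) = ⨆_c V(univ, w_N q_c, k′) ↔ rank H_k(Σ q_c) = rank [H_k(q_c)]_c`**
(`k + k′ = N`, every field). -/
theorem V_w_sum_eq_iSup_V_iff_rank {k k' : ℕ} (hkk' : k + k' = N) (q : ι → ℕ → K) :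
    V K (In N) Finset.univ (w K N N (∑ c, q c)) k' = ⨆ c, V K (In N) Finset.univ (w K N N (q c)) k'
      ↔ (hankel1 K N k (∑ c, q c)).rank = (hank K N k (fun (_ : Unit) (c : ι) => q c)).rank := by
  have h1 := finrank_V_w_mirror K hkk' (∑ c, q c)
  have h2 := finrank_iSup_V_w K hkk' q
  have hpos := Nat.choose_pos (show k ≤ N by omega)
  constructor
  · intro h
    rw [h] at h1
    exact Nat.eq_of_mul_eq_mul_left hpos (h1.symm.trans h2)
  · intro h
    exact Submodule.eq_of_le_of_finrank_eq (V_w_sum_le_iSup_V K k' q) (by rw [h1, h2, h])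

/-- **KERNELS INTERSECT ⇔ IMAGES ADD: `Kr(w_N(Σ q_c), k) = Hom ⊓ ⋂_c Kr(w_N q_c, k) ↔ V(w_N(Σ q_c), k′) = ⨆_c V(w_N q_c, k′)`** (`k + k′ = N`; both say `rank H_k(Σ q_c) = rank [H_k(q_c)]_c`). -/
theorem Kr_w_sum_eq_Hom_iInf_Kr_iff_V_w_sum_eq_iSup {k k' : ℕ} (hkk' : k + k' = N) (q : ι → ℕ → K) :
    Kr K (Finset.univ : Finset (In N)) (w K N N (∑ c, q c)) k = Hom K (In N) (Finset.univ : Finset (In N)) k ⊓ ⨅ c, Kr K (Finset.univ : Finset (In N)) (w K N N (q c)) k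
      ↔ V K (In N) Finset.univ (w K N N (∑ c, q c)) k' = ⨆ c, V K (In N) Finset.univ (w K N N (q c)) k' := by
  rw [Kr_w_sum_eq_Hom_iInf_Kr_iff_rank, V_w_sum_eq_iSup_V_iff_rank K hkk']

/-- under ADDITIVE RANK the joint image has dimension the sum of the image dimensions: `dim ⨆_c V(univ, w_N q_c, k′) = Σ_c dim V(univ, w_N q_c, k′)` (`k + k′ = N`). -/
theorem finrank_iSup_V_w_eq_sum_of_rank_eq_sum {k k' : ℕ} (hkk' : k + k' = N) (q : ι → ℕ → K) (h : (hankel1 K N k (∑ c, q c)).rank = ∑ c, (hankel1 K N k (q c)).rank) :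
    finrank K ↥(⨆ c, V K (In N) Finset.univ (w K N N (q c)) k') = ∑ c, finrank K ↥(V K (In N) Finset.univ (w K N N (q c)) k') := by
  rw [finrank_iSup_V_w K hkk' q, rank_hank_eq_sum_rank_of_eq_sum K k q h, Finset.mul_sum]
  exact Finset.sum_congr rfl fun c _ => (finrank_V_w_mirror K hkk' (q c)).symm

/-- **ADDITIVE RANK ⇒ THE IMAGES ARE INDEPENDENT: `rank H_k(Σ q_c) = Σ rank H_k(q_c) ⇒ iSupIndep (c ↦ V(univ, w_N q_c, k′))`** (`k + k′ = N`) — the sum `⨆_c V(w_N q_c, k′)` is DIRECT. -/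
theorem iSupIndep_V_w_of_rank_eq_sum {k k' : ℕ} (hkk' : k + k' = N) (q : ι → ℕ → K) (h : (hankel1 K N k (∑ c, q c)).rank = ∑ c, (hankel1 K N k (q c)).rank) :
    iSupIndep (fun c => V K (In N) Finset.univ (w K N N (q c)) k') :=
  Literature.LinearAlgebra.iSupIndep_of_finrank_iSup_eq_sum (finrank_iSup_V_w_eq_sum_of_rank_eq_sum K hkk' q h)

/-- **ADDITIVE RANK ⇒ THE IMAGE OF THE SUM IS THE (DIRECT) SUM OF THE IMAGES: `V(univ, w_N(Σ q_c), k′) = ⨆_c V(univ, w_N q_c, k′)`** (`k + k′ = N`; F2d/F8/G1 are instances). -/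
theorem V_w_sum_eq_iSup_V_of_rank_eq_sum {k k' : ℕ} (hkk' : k + k' = N) (q : ι → ℕ → K) (h : (hankel1 K N k (∑ c, q c)).rank = ∑ c, (hankel1 K N k (q c)).rank) :
    V K (In N) Finset.univ (w K N N (∑ c, q c)) k' = ⨆ c, V K (In N) Finset.univ (w K N N (q c)) k' :=
  (V_w_sum_eq_iSup_V_iff_rank K hkk' q).mpr (rank_hankel1_sum_eq_rank_hank_of_eq_sum K k q h)

end Summit.Ventures.HSemireg.Wedge.HankelOuter
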